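import Mathlib
import Summits.Ventures.PercRepro2.PatternDownDom
import Summits.Ventures.PercRepro2.GradedSP
import Summits.Ventures.PercRepro2.GradedHall

/-! # The graded Hall families G_k and V2_k hold on every series–parallel PATTERN, at graph level
(seat mine-b, cell pub-perc-repro2; conjectures/MINE-B.md §21)

GradedSP.lean proves the whole graded family `{G_k, V2_k : k ≥ 2}` on the abstract series–parallel
networks `SP`.  Here the same induction is run over the graph-level class `IsSP` of PatternV2SP.lean,
with the flow labels `rLabP = F_R`, `bLabP = F_B` on the configuration cube of a pattern `(O, Y)`:
the level Harris inequalities hold on EVERY pattern cube (`harris_level_pattern`, PatternDownDom.lean),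
the two compositions are transported along `splitIso` (`labels_series` / `labels_parallel`), the atoms
are checked at every level, and the induction gives

  `IsSP.gDom : IsSP ends s t O Y → ∀ k, GDom k (rLabP ends s t O Y) (bLabP ends s t O Y)`
  `IsSP.vDom : IsSP ends s t O Y → ∀ k, 2 ≤ k → VDom k (rLabP ends s t O Y) (bLabP ends s t O Y)`

— on every series–parallel pattern and at every level `k ≥ 2`, every lower set `D` of the
configuration cube has `#(D ∩ {F_R = 1, F_B ≥ k−1}) ≥ Σ_{D ∩ {F_R = 0, F_B ≥ k}} F_B` and
`#(D ∩ {F_B = k−1, F_R ≥ 1}) ≥ Σ_{D ∩ {F_R = 0, F_B ≥ k}} F_B`; the counts are the rows `(U_k)`.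
By the Hall reading (GradedHall.lean) these are PRIVATE ASSIGNMENTS (`IsSP.exists_private_graded_targets`,
`IsSP.exists_private_level_targets`): every configuration `γ` with `F_R(γ) = 0`, `F_B(γ) = a ≥ k` owns `a`
private `γ′ ⊆ γ` with `F_R(γ′) = 1` AND `F_B(γ′) ≥ k − 1` — the level-conditioned statement of
MINE-B.md §18.1(a), one level at a time — and `a` private `γ′ ⊆ γ` with `F_B(γ′) = k − 1`, `F_R(γ′) ≥ 1`. -/

open Finset

namespace Summit.Ventures.PercRepro2.V2Closure

open Summit.Ventures.PercRepro2.UHClosure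

section Transport

variable {X X' : Type*} [Preorder X] [Preorder X'] [Fintype X] [Fintype X'] [DecidableEq X']

/-- `G_k` transports along a label-preserving order isomorphism -/
theorem gDom_of_orderIso (k : ℕ) (e : X ≃o X') (r b : X → ℕ) (r' b' : X' → ℕ) (hr : ∀ x, r' (e x) = r x)
    (hb : ∀ x, b' (e x) = b x) (h : GDom k r b) : GDom k r' b' :=
  lower_nonneg_of_orderIso e (fun x => gw k (r x) (b x)) (fun x => gw k (r' x) (b' x))
    (fun x => by simp only [hr, hb]) h

/-- `V2_k` transports along a label-preserving order isomorphism -/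
theorem vDom_of_orderIso (k : ℕ) (e : X ≃o X') (r b : X → ℕ) (r' b' : X' → ℕ) (hr : ∀ x, r' (e x) = r x)
    (hb : ∀ x, b' (e x) = b x) (h : VDom k r b) : VDom k r' b' :=
  lower_nonneg_of_orderIso e (fun x => vw k (r x) (b x)) (fun x => vw k (r' x) (b' x))
    (fun x => by simp only [hr, hb]) h

end Transport

section Patterns

variable {V : Type*} {E : Type*} [DecidableEq E] [Fintype E]

/-- **the level Harris inequalities on every pattern cube** (PatternDownDom.lean's
`harris_level_pattern`, packaged as `LevelHarris`) -/
theorem levelHarris_pattern {ends : E → Sym2 V} {s t : V} (hst : s ≠ t) (O Y : Finset E) :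
    LevelHarris (rLabP ends s t O Y) (bLabP ends s t O Y) :=
  fun D hD j => harris_level_pattern hst O Y D hD j

/-- the family `{G_j, V2_j : j ≥ 2}` on a pattern -/
def GradedFamily (ends : E → Sym2 V) (s t : V) (O Y : Finset E) : Prop :=
  ∀ j, 2 ≤ j → GDom j (rLabP ends s t O Y) (bLabP ends s t O Y) ∧ VDom j (rLabP ends s t O Y) (bLabP ends s t O Y)

/-- **the graded family passes to a series composition of patterns** -/
theorem graded_series_pattern {ends : E → Sym2 V} {s v t : V} {O₁ Y₁ O₂ Y₂ : Finset E}
    (hE : SharesOnlyVertex ends v (O₁ ∪ Y₁) (O₂ ∪ Y₂)) (hs : ∀ e ∈ O₂ ∪ Y₂, s ∉ ends e)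
    (ht : ∀ e ∈ O₁ ∪ Y₁, t ∉ ends e) (hsv : s ≠ v) (htv : t ≠ v) (hst : s ≠ t)
    (hdisj : Disjoint (O₁ ∪ Y₁) (O₂ ∪ Y₂)) (hdY : Disjoint Y₁ Y₂)
    (h₁ : GradedFamily ends s v O₁ Y₁) (h₂ : GradedFamily ends v t O₂ Y₂) :
    GradedFamily ends s t (O₁ ∪ O₂) (Y₁ ∪ Y₂) := by
  intro j hj
  have hl := labels_series hE hs ht hsv htv hst hdisj hdY
  exact ⟨gDom_of_orderIso j (splitIso Y₁ Y₂ hdY).symm _ _ _ _ (fun p => (hl p).1) (fun p => (hl p).2)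
      (gDom_ser j hj _ _ _ _ (h₁ j hj).1 (h₁ j hj).2 (h₂ j hj).1 (h₂ j hj).2),
    vDom_of_orderIso j (splitIso Y₁ Y₂ hdY).symm _ _ _ _ (fun p => (hl p).1) (fun p => (hl p).2)
      (vDom_ser j hj _ _ _ _ (h₁ j hj).2 (h₂ j hj).2)⟩

/-- **the graded family passes to a parallel composition of patterns** ((UH) of the parts supplies
the levels `≤ 1` of the `G` family, the cubes supply the level Harris inequalities) -/
theorem graded_parallel_pattern [DecidableEq V] {ends : E → Sym2 V} {s t : V} {O₁ Y₁ O₂ Y₂ : Finset E}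
    (hE : SharesOnlyPair ends s t (O₁ ∪ Y₁) (O₂ ∪ Y₂)) (hst : s ≠ t)
    (hdisj : Disjoint (O₁ ∪ Y₁) (O₂ ∪ Y₂)) (hdY : Disjoint Y₁ Y₂)
    (hd₁ : DownDom (rLabP ends s t O₁ Y₁) (bLabP ends s t O₁ Y₁))
    (hd₂ : DownDom (rLabP ends s t O₂ Y₂) (bLabP ends s t O₂ Y₂))
    (h₁ : GradedFamily ends s t O₁ Y₁) (h₂ : GradedFamily ends s t O₂ Y₂) :
    GradedFamily ends s t (O₁ ∪ O₂) (Y₁ ∪ Y₂) := by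
  intro j hj
  have hl := labels_parallel hE hst hdisj hdY
  refine ⟨gDom_of_orderIso j (splitIso Y₁ Y₂ hdY).symm _ _ _ _ (fun p => (hl p).1) (fun p => (hl p).2)
      (gDom_par_le j _ _ _ _ (gDom_le_of _ _ hd₁ (fun i hi => (h₁ i hi).1) j)
        (gDom_le_of _ _ hd₂ (fun i hi => (h₂ i hi).1) j)), ?_⟩
  refine vDom_of_orderIso j (splitIso Y₁ Y₂ hdY).symm _ _ _ _ (fun p => (hl p).1) (fun p => (hl p).2) ?_
  rcases Nat.lt_or_ge j 3 with h3 | h3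
  · have hj2 : j = 2 := by omega
    subst hj2
    exact vDom_par2 _ _ _ _ (h₁ 2 le_rfl).2 (levelHarris_pattern hst O₁ Y₁) (h₂ 2 le_rfl).2
      (levelHarris_pattern hst O₂ Y₂)
  · exact vDom_par j h3 _ _ _ _ (fun i hi _ => (h₁ i hi).2) (levelHarris_pattern hst O₁ Y₁)
      (fun i hi _ => (h₂ i hi).2) (levelHarris_pattern hst O₂ Y₂)

/-- the absent edge carries the family: flows `(0, 0)`, all weights vanish -/
theorem graded_absent_atom (ends : E → Sym2 V) (s t : V) : GradedFamily ends s t ∅ ∅ := by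
  have hr : ∀ S : Conf (∅ : Finset E), rLabP ends s t ∅ ∅ S = 0 := by
    intro S; unfold rLabP; rw [conf_empty_eq S]; simp [flow_empty]
  have hb : ∀ S : Conf (∅ : Finset E), bLabP ends s t ∅ ∅ S = 0 := by
    intro S; unfold bLabP; rw [conf_empty_eq S]; simp [flow_empty]
  intro j _
  constructor
  · intro W _
    apply Finset.sum_nonneg; intro S _
    simp [gw, hr, hb]
  · intro W _
    apply Finset.sum_nonneg; intro S _
    simp [vw, hr, hb]

/-- the pinned edge carries the family: flows `(1, 1)`, non-negative weights -/
theorem graded_pin_atom {ends : E → Sym2 V} {s t : V} (hst : s ≠ t) {f : E} (hf : ends f = s(s, t)) :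
    GradedFamily ends s t {f} ∅ := by
  have hr : ∀ S : Conf (∅ : Finset E), rLabP ends s t {f} ∅ S = 1 := by
    intro S; unfold rLabP; rw [conf_empty_eq S]; simp [flow_single hst hf]
  have hb : ∀ S : Conf (∅ : Finset E), bLabP ends s t {f} ∅ S = 1 := by
    intro S; unfold bLabP; rw [conf_empty_eq S]; simp [flow_single hst hf]
  intro j _
  constructor
  · intro W _
    apply Finset.sum_nonneg; intro S _
    unfold gw; simp [hr, hb]; split_ifs <;> norm_num
  · intro W _
    apply Finset.sum_nonneg; intro S _
    unfold vw; simp [hr, hb]; split_ifs <;> norm_num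

/-- the free edge carries the family: flows `(1, 0)` and `(0, 1)`, all weights of the levels `≥ 2` vanish -/
theorem graded_free_atom {ends : E → Sym2 V} {s t : V} (hst : s ≠ t) {f : E} (hf : ends f = s(s, t)) :
    GradedFamily ends s t ∅ {f} := by
  have hr : ∀ S : Conf ({f} : Finset E), rLabP ends s t ∅ {f} S = if S.1 = ∅ then 1 else 0 := by
    intro S; unfold rLabP
    rcases conf_single_cases S with h | h <;> rw [h] <;> simp [flow_single hst hf, flow_empty]
  have hb : ∀ S : Conf ({f} : Finset E), bLabP ends s t ∅ {f} S = if S.1 = ∅ then 0 else 1 := by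
    intro S; unfold bLabP
    rcases conf_single_cases S with h | h <;> rw [h] <;> simp [flow_single hst hf, flow_empty]
  intro j hj
  constructor
  · intro W _
    apply Finset.sum_nonneg; intro S _
    rw [gw, hr, hb]
    split_ifs <;> omega
  · intro W _
    apply Finset.sum_nonneg; intro S _
    rw [vw, hr, hb]
    split_ifs <;> omega

end Patterns

section SP

variable {V : Type*} {E : Type*} [DecidableEq V] [DecidableEq E] [Fintype E]

/-- **the graded family `{G_j, V2_j : j ≥ 2}` holds on every series–parallel pattern** (induction over
`IsSP`; (UH) of the parts from `IsSP.downDom`) -/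
theorem IsSP.gradedFamily {ends : E → Sym2 V} {s t : V} {O Y : Finset E} (h : IsSP ends s t O Y) :
    GradedFamily ends s t O Y := by
  induction h with
  | free hst hf => exact graded_free_atom hst hf
  | pin hst hf => exact graded_pin_atom hst hf
  | absent => exact graded_absent_atom ends _ _
  | ser _ _ hE hs ht hsv htv hst hdisj hdY ih₁ ih₂ =>
      exact graded_series_pattern hE hs ht hsv htv hst hdisj hdY ih₁ ih₂
  | par h₁ h₂ hE hst hdisj hdY ih₁ ih₂ =>
      exact graded_parallel_pattern hE hst hdisj hdY h₁.downDom h₂.downDom ih₁ ih₂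

/-- **`G_k` on every series–parallel pattern, at every level `k`**: every lower set `D` of the
configuration cube has `#(D ∩ {F_R = 1, F_B ≥ k−1}) ≥ Σ_{D ∩ {F_R = 0, F_B ≥ k}} F_B`
(by Hall: every configuration with `F_R = 0`, `F_B = a ≥ k` owns `a` private configurations below it
with `F_R = 1` and `F_B ≥ k − 1`). -/
theorem IsSP.gDom {ends : E → Sym2 V} {s t : V} {O Y : Finset E} (h : IsSP ends s t O Y) (k : ℕ) :
    GDom k (rLabP ends s t O Y) (bLabP ends s t O Y) := by
  rcases Nat.lt_or_ge k 2 with hk | hk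
  · exact gDom_of_downDom k (by omega) _ _ h.downDom
  · exact (h.gradedFamily k hk).1

/-- **`V2_k` on every series–parallel pattern, at every level `k ≥ 2`**: every lower set `D` has
`#(D ∩ {F_B = k−1, F_R ≥ 1}) ≥ Σ_{D ∩ {F_R = 0, F_B ≥ k}} F_B`. -/
theorem IsSP.vDom {ends : E → Sym2 V} {s t : V} {O Y : Finset E} (h : IsSP ends s t O Y) (k : ℕ)
    (hk : 2 ≤ k) : VDom k (rLabP ends s t O Y) (bLabP ends s t O Y) :=
  (h.gradedFamily k hk).2

/-- the count `(U_k)` of a series–parallel pattern: `#{F_R = 1, F_B ≥ k−1} ≥ Σ_{F_R = 0, F_B ≥ k} F_B` -/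
theorem IsSP.sum_gw_nonneg {ends : E → Sym2 V} {s t : V} {O Y : Finset E} (h : IsSP ends s t O Y) (k : ℕ) :
    0 ≤ ∑ S : Conf Y, gw k (rLabP ends s t O Y S) (bLabP ends s t O Y S) :=
  h.gDom k univ (by simp [isLowerSet_univ])

/-- the count of `V2_k` on a series–parallel pattern: `#{F_B = k−1, F_R ≥ 1} ≥ Σ_{F_R = 0, F_B ≥ k} F_B` -/
theorem IsSP.sum_vw_nonneg {ends : E → Sym2 V} {s t : V} {O Y : Finset E} (h : IsSP ends s t O Y) (k : ℕ)
    (hk : 2 ≤ k) : 0 ≤ ∑ S : Conf Y, vw k (rLabP ends s t O Y S) (bLabP ends s t O Y S) :=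
  h.vDom k hk univ (by simp [isLowerSet_univ])

/-- **`G_k` on every series–parallel pattern as a private assignment**: every `γ` with `F_R(γ) = 0`,
`F_B(γ) ≥ k` (and `≥ 1`) owns `F_B(γ)` private configurations `γ′ ⊆ γ` with `F_R(γ′) = 1` and
`F_B(γ′) ≥ k − 1` (an injective map on the slots `(γ, i < F_B γ)`). -/
theorem IsSP.exists_private_graded_targets {ends : E → Sym2 V} {s t : V} {O Y : Finset E}
    (h : IsSP ends s t O Y) (k : ℕ) :
    ∃ f : SlotL (fun S : Conf Y => rLabP ends s t O Y S = 0 ∧ k ≤ bLabP ends s t O Y S) (bLabP ends s t O Y)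
        → Conf Y,
      Function.Injective f ∧ ∀ p, (f p).1 ⊆ p.1.1.1.1 ∧ rLabP ends s t O Y (f p) = 1 ∧
        k - 1 ≤ bLabP ends s t O Y (f p) := by
  classical
  obtain ⟨f, hf, hspec⟩ := exists_private_targets_of_gDom k (rLabP ends s t O Y) (bLabP ends s t O Y) (h.gDom k)
  exact ⟨f, hf, fun p => ⟨(hspec p).1, (hspec p).2.1, (hspec p).2.2⟩⟩

/-- **`V2_k` on every series–parallel pattern as a private assignment**: every `γ` with `F_R(γ) = 0`,
`F_B(γ) ≥ k ≥ 2` owns `F_B(γ)` private configurations `γ′ ⊆ γ` with `F_B(γ′) = k − 1` and `F_R(γ′) ≥ 1`. -/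
theorem IsSP.exists_private_level_targets {ends : E → Sym2 V} {s t : V} {O Y : Finset E}
    (h : IsSP ends s t O Y) (k : ℕ) (hk : 2 ≤ k) :
    ∃ f : SlotL (fun S : Conf Y => rLabP ends s t O Y S = 0 ∧ k ≤ bLabP ends s t O Y S) (bLabP ends s t O Y)
        → Conf Y,
      Function.Injective f ∧ ∀ p, (f p).1 ⊆ p.1.1.1.1 ∧ bLabP ends s t O Y (f p) = k - 1 ∧
        1 ≤ rLabP ends s t O Y (f p) := by
  classical
  obtain ⟨f, hf, hspec⟩ := exists_private_targets_of_vDom k (rLabP ends s t O Y) (bLabP ends s t O Y) (h.vDom k hk)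
  exact ⟨f, hf, fun p => ⟨(hspec p).1, (hspec p).2.1, (hspec p).2.2⟩⟩

end SP

end Summit.Ventures.PercRepro2.V2Closure
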